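import Summits.NavierStokesRegularity.NavierStokesRegularity.Theses.AxisymmetricExtremality
import Literature.Analysis.FluidPDE.AxisymRadialQuotient
import HarnessLib

/-!
# The Hmidi–Rousset identity `(∂ᵣZ)/r = sin²θ ∂₀∂₀Z − 2 sinθ cosθ ∂₀∂₁Z + cos²θ ∂₁∂₁Z` for
# axisymmetric scalars — crux stmt-NavierStokesRegularity-15453 (`AxisymmetricExtremality.AxisymmetricKatoGlobal`), line registered, support for stub `stub_sereginLogSwirlOrigin`

Support file (`--supports stmt-NavierStokesRegularity-15453`; theorems only, everything proved)
toward the registered stub `stub_sereginLogSwirlOrigin` = the named fact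
`Literature.Analysis.FluidPDE.seregin2022_logSwirl_regularAtOrigin` (G. Seregin, J. Math. Fluid
Mech. 24 (2022), Paper 27 = arXiv:2201.00153, §2). Lemma 2.1 there (Step 2, arXiv p. 5) writes
`v_r/r = W + Z` with `Z = (1/r) Z_{0,r}`, `Z_0 = Δ⁻¹ f` the Newton potential of an axisymmetric
`f`, and invokes "according to Proposition 2.9 of paper [HR2011], the following identity is valid:
`Z = sin²θ Z_{0,11} − 2 cosθ sinθ Z_{0,12} + cos²θ Z_{0,22}`" (T. Hmidi, F. Rousset, J. Funct.
Anal. 260 (2011) 745–796, Prop. 2.9; also Chen–Fang–Zhang 2017, Lemma 2.3, and Miao–Zheng 2013,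
Prop. 2.5) to turn `(Δ⁻¹f)_{,r}/r` into second Cartesian derivatives, to which Calderón–Zygmund
theory applies (tree: `exists_eLpNorm_hessian_newtonPotential_le`). This file proves that identity
as pure calculus, for every axisymmetric scalar `Z : ℝ³ → ℝ` (`IsAxisymmetricScalar Z`,
`Z (R_θ x) = Z x`) of class `C²`, with `cos θ = x₀/r`, `sin θ = x₁/r`, `r² = x₀² + x₁²`
(`r = cylRadius x`), `∂ᵣZ = DZ(x)[e_r]` (`eR`), and
`∂_b∂_aZ (x) = fderiv ℝ (fun y => fderiv ℝ Z y e_a) x e_b`: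

* `hmidiRousset_identity` (registered sub-goal; division-free, valid on the axis too):
  `x₁² ∂₀∂₀Z − 2 x₀x₁ ∂₁∂₀Z + x₀² ∂₁∂₁Z = x₀ ∂₀Z + x₁ ∂₁Z (= r ∂ᵣZ)` everywhere on `ℝ³` for
  `Z ∈ C²`; pointwise version `hmidiRousset_identity_of_contDiffAt` under `ContDiffAt ℝ 2 Z x`
  only, and `hmidiRousset_identity_of_contDiffOn` on an open set;
* `hmidiRousset_identity_eq_sq_mul_radDerivQuot`: the same left-hand side equals
  `r² · radDerivQuot Z x`, `radDerivQuot Z` being the tree's smooth `(∂ᵣZ)/r`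
  (`AxisymRadialQuotient`), and `fderiv_apply_eR_eq_cylRadius_mul_radDerivQuot`:
  `∂ᵣZ = r · radDerivQuot Z x` everywhere;
* `radDeriv_div_cylRadius_eq_of_isAxisymmetricScalar` (the printed form, off the axis):
  `∂ᵣZ / r = (x₁² ∂₀∂₀Z − 2 x₀x₁ ∂₁∂₀Z + x₀² ∂₁∂₁Z) / r²` for `0 < r`, and
  `radDerivQuot_eq_trig` : `(∂ᵣZ)/r = (x₁/r)² ∂₀∂₀Z − 2 (x₀/r)(x₁/r) ∂₁∂₀Z + (x₀/r)² ∂₁∂₁Z`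
  (`sin²θ Z₀₀ − 2 sinθ cosθ Z₀₁ + cos²θ Z₁₁`) for `r ≠ 0`.

Proof (no cylindrical coordinates): the angular derivative of an axisymmetric scalar vanishes,
`A(y) := DZ(y)[J y] = y₀∂₁Z − y₁∂₀Z = 0` (`IsAxisymmetricScalar.fderiv_rotGen`, `J = rotGen`);
differentiating `A ≡ 0` along `a` gives `DZ(x)[J a] + D²Z(x)[a, J x] = 0`
(`fderiv_rotGen_add_fderiv_fderiv_rotGen_eq_zero`), i.e. for `a = e₀, e₁`:
`∂₁Z + x₀ ∂₀∂₁Z − x₁ ∂₀∂₀Z = 0` and `−∂₀Z + x₀ ∂₁∂₁Z − x₁ ∂₁∂₀Z = 0`; `−x₁ ·` the first plus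
`x₀ ·` the second and the symmetry `∂₀∂₁Z = ∂₁∂₀Z` (`ContDiffAt.isSymmSndFDerivAt`) give the claim.

## Mathlib / tree search

`lean search 'hmidiRousset|HmidiRousset|Hmidi'`: no matches (2026-08-17). Tree inputs:
`IsAxisymmetricScalar.fderiv_rotGen`, `rotGen_eq_sub_single`, `rotGen_single_zero/one`,
`rotGenL` (`SwirlTransportProofs`); `radDerivQuot`, `mul_radDerivQuot_eq_fderiv_zero/one`,
`fderiv_apply_horizontal_eq` (`AxisymRadialQuotient`); `toLp_horizontal_eq_add_single`, `eR`,
`cylRadius_sq` (`AxisymmetricEuler`). Nearby but different: `laplacianH_eq_two_mul_radDerivQuot_add`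
(`HouLeiLiEstimate`, the trace `∂₀∂₀ + ∂₁∂₁`) and
`IsAxisymmetricScalar.mul_fderiv_fderiv_single_one` (`AxisymmetricLiftR5`, the identity on the
meridian plane `{x₁ = 0}` only), whose differentiation of `DZ[J ·] ≡ 0` is adapted here.
Mathlib: `HasFDerivAt.clm_apply`, `fderiv_clm_apply`, `ContDiffAt.isSymmSndFDerivAt`,
`ContDiffAt.eventually`, `HasFDerivAt.congr_of_eventuallyEq`.

## References

* G. Seregin, J. Math. Fluid Mech. 24 (2022), Paper No. 27 = arXiv:2201.00153, §2, Lemma 2.1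
  (arXiv p. 5). [`Seregin2022LocalAxisym`]
* T. Hmidi, F. Rousset, *Global well-posedness for the Euler–Boussinesq system with axisymmetric
  data*, J. Funct. Anal. 260 (2011) 745–796, Proposition 2.9. [`HmidiRousset2011`]
* H. Chen, D. Fang, T. Zhang, Discrete Contin. Dyn. Syst. 37 (2017) 1923–1939, Lemma 2.3.
  [`ChenFangZhang2017`]
-/

noncomputable section

open Set Filter Topology Function
open Literature.Analysis.FluidPDE

-- `<Problem> = <Summit>` duplicates a namespace component by design (lakefile sets the same option).
set_option linter.dupNamespace false

namespace Summit.NavierStokesRegularity.NavierStokesRegularity.Theorems.AxisymmetricKatoGlobal.EulerScaling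

section Pointwise

variable {Z : EuclideanSpace ℝ (Fin 3) → ℝ} {x : EuclideanSpace ℝ (Fin 3)}

/-- A `C²` germ has a differentiable derivative: `D(DZ)` exists at `x`. [folklore] -/
private theorem differentiableAt_fderiv_of_contDiffAt_two (hZ : ContDiffAt ℝ 2 Z x) :
    DifferentiableAt ℝ (fderiv ℝ Z) x :=
  (hZ.fderiv_right (m := 1) (by norm_num)).differentiableAt one_ne_zero

/-- Directional second derivatives as values of `D(DZ)`: `∂_b (y ↦ DZ(y)[a]) (x) = D²Z(x)[b][a]`
for a `C²` germ. [folklore] -/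
private theorem fderiv_fderiv_apply_eq (hZ : ContDiffAt ℝ 2 Z x) (a b : EuclideanSpace ℝ (Fin 3)) :
    fderiv ℝ (fun y => fderiv ℝ Z y a) x b = fderiv ℝ (fderiv ℝ Z) x b a := by
  rw [fderiv_clm_apply (differentiableAt_fderiv_of_contDiffAt_two hZ) (differentiableAt_const a)]
  simp only [fderiv_fun_const, Pi.zero_apply, ContinuousLinearMap.comp_zero, zero_add,
    ContinuousLinearMap.flip_apply]

/-- Mixed second partials of a `C²` germ commute: `D²Z(x)[a][b] = D²Z(x)[b][a]`. [folklore] -/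
private theorem fderiv_fderiv_comm_of_contDiffAt (hZ : ContDiffAt ℝ 2 Z x)
    (a b : EuclideanSpace ℝ (Fin 3)) :
    fderiv ℝ (fderiv ℝ Z) x a b = fderiv ℝ (fderiv ℝ Z) x b a :=
  (hZ.isSymmSndFDerivAt (by simp)) a b

/-- **Differentiated axisymmetry.** For an axisymmetric scalar `Z` of class `C²` near `x`, the
angular derivative `y ↦ DZ(y)[J y]` vanishes identically near `x`, so its derivative along any
`a` vanishes: `DZ(x)[J a] + D²Z(x)[a][J x] = 0` (`J = rotGen`, `J x = x₀e₁ − x₁e₀`). [folklore] -/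
theorem fderiv_rotGen_add_fderiv_fderiv_rotGen_eq_zero (hax : IsAxisymmetricScalar Z)
    (hZ : ContDiffAt ℝ 2 Z x) (a : EuclideanSpace ℝ (Fin 3)) :
    fderiv ℝ Z x (rotGen a) + fderiv ℝ (fderiv ℝ Z) x a (rotGen x) = 0 := by
  have hdg : DifferentiableAt ℝ (fderiv ℝ Z) x := differentiableAt_fderiv_of_contDiffAt_two hZ
  -- `A(y) = DZ(y)[J y]` vanishes near `x`
  have hA : (fun y : EuclideanSpace ℝ (Fin 3) => fderiv ℝ Z y (rotGenL y)) =ᶠ[𝓝 x]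
      fun _ => (0 : ℝ) := by
    filter_upwards [hZ.eventually (by simp)] with y hy
    rw [rotGenL_apply]
    exact hax.fderiv_rotGen (hy.differentiableAt two_ne_zero)
  have h1 : HasFDerivAt (fun y : EuclideanSpace ℝ (Fin 3) => fderiv ℝ Z y (rotGenL y))
      ((fderiv ℝ Z x).comp rotGenL + (fderiv ℝ (fderiv ℝ Z) x).flip (rotGenL x)) x :=
    hdg.hasFDerivAt.clm_apply rotGenL.hasFDerivAt
  have h2 : HasFDerivAt (fun y : EuclideanSpace ℝ (Fin 3) => fderiv ℝ Z y (rotGenL y))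
      (0 : EuclideanSpace ℝ (Fin 3) →L[ℝ] ℝ) x :=
    (hasFDerivAt_const (0 : ℝ) x).congr_of_eventuallyEq hA
  have h3 := congrArg (fun T : EuclideanSpace ℝ (Fin 3) →L[ℝ] ℝ => T a) (h1.unique h2)
  simpa only [_root_.add_apply, ContinuousLinearMap.comp_apply, ContinuousLinearMap.flip_apply,
    rotGenL_apply, _root_.zero_apply] using h3

/-- **Hmidi–Rousset identity, pointwise division-free form.** For an axisymmetric scalar `Z`
(`Z (R_θ x) = Z x`) which is `C²` at `x`:
`x₁² ∂₀∂₀Z − 2 x₀x₁ ∂₁∂₀Z + x₀² ∂₁∂₁Z = x₀ ∂₀Z + x₁ ∂₁Z` at `x` (the right-hand side is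
`r ∂ᵣZ`; dividing by `r²` off the axis gives Prop. 2.9 of Hmidi–Rousset as quoted in Seregin's
Lemma 2.1). [cite: HmidiRousset2011, Prop. 2.9] [cite: Seregin2022LocalAxisym, §2 Lemma 2.1 (arXiv:2201.00153 p. 5)] -/
theorem hmidiRousset_identity_of_contDiffAt (hax : IsAxisymmetricScalar Z)
    (hZ : ContDiffAt ℝ 2 Z x) :
    (x 1) ^ 2 * fderiv ℝ (fun y => fderiv ℝ Z y (EuclideanSpace.single 0 1)) x
          (EuclideanSpace.single 0 1) -
        2 * x 0 * x 1 * fderiv ℝ (fun y => fderiv ℝ Z y (EuclideanSpace.single 0 1)) x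
          (EuclideanSpace.single 1 1) +
        (x 0) ^ 2 * fderiv ℝ (fun y => fderiv ℝ Z y (EuclideanSpace.single 1 1)) x
          (EuclideanSpace.single 1 1) =
      x 0 * fderiv ℝ Z x (EuclideanSpace.single 0 1) +
        x 1 * fderiv ℝ Z x (EuclideanSpace.single 1 1) := by
  rw [fderiv_fderiv_apply_eq hZ (EuclideanSpace.single 0 1) (EuclideanSpace.single 0 1),
    fderiv_fderiv_apply_eq hZ (EuclideanSpace.single 0 1) (EuclideanSpace.single 1 1),
    fderiv_fderiv_apply_eq hZ (EuclideanSpace.single 1 1) (EuclideanSpace.single 1 1)]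
  -- `∂₁Z + x₀ ∂₀∂₁Z − x₁ ∂₀∂₀Z = 0`
  have hI := fderiv_rotGen_add_fderiv_fderiv_rotGen_eq_zero hax hZ (EuclideanSpace.single 0 1)
  rw [rotGen_single_zero, rotGen_eq_sub_single, map_sub, map_smul, map_smul, smul_eq_mul,
    smul_eq_mul] at hI
  -- `−∂₀Z + x₀ ∂₁∂₁Z − x₁ ∂₁∂₀Z = 0`
  have hII := fderiv_rotGen_add_fderiv_fderiv_rotGen_eq_zero hax hZ (EuclideanSpace.single 1 1)
  rw [rotGen_single_one, map_neg, rotGen_eq_sub_single, map_sub, map_smul, map_smul, smul_eq_mul,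
    smul_eq_mul] at hII
  -- `∂₀∂₁Z = ∂₁∂₀Z`
  have hsymm := fderiv_fderiv_comm_of_contDiffAt hZ (EuclideanSpace.single 0 1)
    (EuclideanSpace.single 1 1)
  linear_combination (-(x 1)) * hI + (x 0) * hII + (x 0 * x 1) * hsymm

/-- **Hmidi–Rousset identity on an open set**: the pointwise identity for an axisymmetric scalar
which is `C²` on an open set `U ∋ x` (e.g. off the axis only). [cite: HmidiRousset2011, Prop. 2.9] -/
theorem hmidiRousset_identity_of_contDiffOn {U : Set (EuclideanSpace ℝ (Fin 3))} (hU : IsOpen U)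
    (hax : IsAxisymmetricScalar Z) (hZ : ContDiffOn ℝ 2 Z U) (hx : x ∈ U) :
    (x 1) ^ 2 * fderiv ℝ (fun y => fderiv ℝ Z y (EuclideanSpace.single 0 1)) x
          (EuclideanSpace.single 0 1) -
        2 * x 0 * x 1 * fderiv ℝ (fun y => fderiv ℝ Z y (EuclideanSpace.single 0 1)) x
          (EuclideanSpace.single 1 1) +
        (x 0) ^ 2 * fderiv ℝ (fun y => fderiv ℝ Z y (EuclideanSpace.single 1 1)) x
          (EuclideanSpace.single 1 1) =
      x 0 * fderiv ℝ Z x (EuclideanSpace.single 0 1) +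
        x 1 * fderiv ℝ Z x (EuclideanSpace.single 1 1) :=
  hmidiRousset_identity_of_contDiffAt hax (hZ.contDiffAt (hU.mem_nhds hx))

end Pointwise

/-- **Hmidi–Rousset identity (Hmidi–Rousset 2011, Prop. 2.9, as used in Seregin 2022,
Lemma 2.1), division-free Cartesian form.** For every axisymmetric scalar `Z : ℝ³ → ℝ` of class
`C²` and every `x ∈ ℝ³`,
`x₁² ∂₀∂₀Z − 2 x₀x₁ ∂₁∂₀Z + x₀² ∂₁∂₁Z = x₀ ∂₀Z + x₁ ∂₁Z`,
where `∂_b∂_aZ (x) = fderiv ℝ (fun y => fderiv ℝ Z y e_a) x e_b`, `e₀ = EuclideanSpace.single 0 1`,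
`e₁ = EuclideanSpace.single 1 1`; the right-hand side is `r ∂ᵣZ`, so off the axis this is
`(∂ᵣZ)/r = sin²θ ∂₀∂₀Z − 2 sinθ cosθ ∂₀∂₁Z + cos²θ ∂₁∂₁Z` (`cos θ = x₀/r`, `sin θ = x₁/r`).
Registered sub-goal toward `stub_sereginLogSwirlOrigin`. [cite: HmidiRousset2011, Prop. 2.9] [cite: Seregin2022LocalAxisym, §2 Lemma 2.1 (arXiv:2201.00153 p. 5)] -/
theorem hmidiRousset_identity : ∀ (Z : EuclideanSpace ℝ (Fin 3) → ℝ), ContDiff ℝ 2 Z → IsAxisymmetricScalar Z → ∀ x : EuclideanSpace ℝ (Fin 3), (x 1) ^ 2 * fderiv ℝ (fun y => fderiv ℝ Z y (EuclideanSpace.single 0 1)) x (EuclideanSpace.single 0 1) - 2 * x 0 * x 1 * fderiv ℝ (fun y => fderiv ℝ Z y (EuclideanSpace.single 0 1)) x (EuclideanSpace.single 1 1) + (x 0) ^ 2 * fderiv ℝ (fun y => fderiv ℝ Z y (EuclideanSpace.single 1 1)) x (EuclideanSpace.single 1 1) = x 0 * fderiv ℝ Z x (EuclideanSpace.single 0 1)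 + x 1 * fderiv ℝ Z x (EuclideanSpace.single 1 1) :=
  fun _ hZ hax _ => hmidiRousset_identity_of_contDiffAt hax hZ.contDiffAt

section Radial

variable {Z : EuclideanSpace ℝ (Fin 3) → ℝ}

/-- **Hmidi–Rousset identity through the smooth radial derivative quotient**: for an axisymmetric
scalar `Z ∈ C²`, everywhere on `ℝ³` (axis included),
`x₁² ∂₀∂₀Z − 2 x₀x₁ ∂₁∂₀Z + x₀² ∂₁∂₁Z = r² · radDerivQuot Z x`, where `radDerivQuot Z` is the
smooth function equal to `(∂ᵣZ)/r` off the axis (`AxisymRadialQuotient`). [cite: HmidiRousset2011, Prop. 2.9] -/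
theorem hmidiRousset_identity_eq_sq_mul_radDerivQuot (hZ : ContDiff ℝ 2 Z)
    (hax : IsAxisymmetricScalar Z) (x : EuclideanSpace ℝ (Fin 3)) :
    (x 1) ^ 2 * fderiv ℝ (fun y => fderiv ℝ Z y (EuclideanSpace.single 0 1)) x
          (EuclideanSpace.single 0 1) -
        2 * x 0 * x 1 * fderiv ℝ (fun y => fderiv ℝ Z y (EuclideanSpace.single 0 1)) x
          (EuclideanSpace.single 1 1) +
        (x 0) ^ 2 * fderiv ℝ (fun y => fderiv ℝ Z y (EuclideanSpace.single 1 1)) x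
          (EuclideanSpace.single 1 1) =
      cylRadius x ^ 2 * radDerivQuot Z x := by
  rw [hmidiRousset_identity_of_contDiffAt hax hZ.contDiffAt,
    ← mul_radDerivQuot_eq_fderiv_zero hZ hax x, ← mul_radDerivQuot_eq_fderiv_one hZ hax x,
    cylRadius_sq]
  ring

/-- **The radial derivative through the quotient**: `∂ᵣZ = DZ(x)[e_r] = r · radDerivQuot Z x`
everywhere, for an axisymmetric scalar `Z ∈ C²` (on the axis both sides vanish, `eR = 0` there
by its junk value). [folklore] -/
theorem fderiv_apply_eR_eq_cylRadius_mul_radDerivQuot (hZ : ContDiff ℝ 2 Z)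
    (hax : IsAxisymmetricScalar Z) (x : EuclideanSpace ℝ (Fin 3)) :
    fderiv ℝ Z x (eR x) = cylRadius x * radDerivQuot Z x := by
  rw [eR, toLp_horizontal_eq_add_single, map_smul, fderiv_apply_horizontal_eq hZ hax x,
    smul_eq_mul]
  by_cases hr : cylRadius x = 0
  · rw [hr, inv_zero, zero_mul, zero_mul]
  · rw [← mul_assoc, sq, inv_mul_cancel_left₀ hr]

/-- **Hmidi–Rousset identity, printed form** (Seregin 2022, Lemma 2.1: "`Z = (1/r) Z_{0,r}` …
according to Proposition 2.9 of [HR2011], `Z = sin²θ Z_{0,11} − 2 cosθ sinθ Z_{0,12} + cos²θ Z_{0,22}`"):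
off the axis, for an axisymmetric scalar `Z ∈ C²`,
`∂ᵣZ / r = (x₁² ∂₀∂₀Z − 2 x₀x₁ ∂₁∂₀Z + x₀² ∂₁∂₁Z) / r²` with `∂ᵣZ = DZ(x)[e_r]`.
[cite: Seregin2022LocalAxisym, §2 Lemma 2.1 (arXiv:2201.00153 p. 5)] [cite: HmidiRousset2011, Prop. 2.9] -/
theorem radDeriv_div_cylRadius_eq_of_isAxisymmetricScalar (hZ : ContDiff ℝ 2 Z)
    (hax : IsAxisymmetricScalar Z) (x : EuclideanSpace ℝ (Fin 3)) (hx : 0 < cylRadius x) :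
    fderiv ℝ Z x (eR x) / cylRadius x =
      ((x 1) ^ 2 * fderiv ℝ (fun y => fderiv ℝ Z y (EuclideanSpace.single 0 1)) x
            (EuclideanSpace.single 0 1) -
          2 * x 0 * x 1 * fderiv ℝ (fun y => fderiv ℝ Z y (EuclideanSpace.single 0 1)) x
            (EuclideanSpace.single 1 1) +
          (x 0) ^ 2 * fderiv ℝ (fun y => fderiv ℝ Z y (EuclideanSpace.single 1 1)) x
            (EuclideanSpace.single 1 1)) / cylRadius x ^ 2 := by
  rw [fderiv_apply_eR_eq_cylRadius_mul_radDerivQuot hZ hax,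
    hmidiRousset_identity_eq_sq_mul_radDerivQuot hZ hax, mul_div_cancel_left₀ _ hx.ne',
    mul_div_cancel_left₀ _ (pow_ne_zero 2 hx.ne')]

/-- **Hmidi–Rousset identity in the angle form** `(∂ᵣZ)/r = sin²θ Z₀₀ − 2 sinθ cosθ Z₀₁ + cos²θ Z₁₁`
with `cos θ = x₀/r`, `sin θ = x₁/r`: off the axis, for an axisymmetric scalar `Z ∈ C²`,
`radDerivQuot Z x = (x₁/r)² ∂₀∂₀Z − 2 (x₀/r)(x₁/r) ∂₁∂₀Z + (x₀/r)² ∂₁∂₁Z`.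
[cite: HmidiRousset2011, Prop. 2.9] -/
theorem radDerivQuot_eq_trig (hZ : ContDiff ℝ 2 Z) (hax : IsAxisymmetricScalar Z)
    {x : EuclideanSpace ℝ (Fin 3)} (hx : cylRadius x ≠ 0) :
    radDerivQuot Z x =
      (x 1 / cylRadius x) ^ 2 * fderiv ℝ (fun y => fderiv ℝ Z y (EuclideanSpace.single 0 1)) x
          (EuclideanSpace.single 0 1) -
        2 * (x 0 / cylRadius x) * (x 1 / cylRadius x) *
          fderiv ℝ (fun y => fderiv ℝ Z y (EuclideanSpace.single 0 1)) x
            (EuclideanSpace.single 1 1) +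
        (x 0 / cylRadius x) ^ 2 * fderiv ℝ (fun y => fderiv ℝ Z y (EuclideanSpace.single 1 1)) x
          (EuclideanSpace.single 1 1) := by
  -- `q = (r² q)/r² = N/r²`, then expand the quotient
  rw [← mul_div_cancel_left₀ (radDerivQuot Z x) (pow_ne_zero 2 hx),
    ← hmidiRousset_identity_eq_sq_mul_radDerivQuot hZ hax x]
  ring

end Radial

end Summit.NavierStokesRegularity.NavierStokesRegularity.Theorems.AxisymmetricKatoGlobal.EulerScaling

end
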